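import Mathlib.Analysis.Meromorphic.Basic
import Literature.NumberTheory.LFunctions.HeckeThetaDirichlet
import Literature.NumberTheory.LFunctions.HeckePieceDirichlet
import HarnessLib

/-!
# The signed coset Dirichlet series `Σ sgn N(x^p) |N(x)|^{-s}` and their meromorphic continuation

Topic `Literature/NumberTheory/LFunctions`; namespace `Literature.NumberTheory.LFunctions.NumberField`
(continuing `HeckeThetaDirichlet.lean` and `HeckePieceDirichlet.lean`).  Sixth step of the continuation of
the partial zeta functions of narrow ray classes (Neukirch, *Algebraic Number Theory*, VII §8 (8.5) Theorem, for
the cosets `a₀ + 𝔞` and sign weights `N(x^p)` of Remark 1 after (8.6)).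

For a nonzero fractional ideal `𝔞`, a shift `a₀`, an even `N ≠ 0` such that `V = ⟨u_i^N⟩` stabilises the
coset (`(u_i^N - 1) a₀ ∈ 𝔞`), and a set `p` of real places, let `ℜ = pieceReps K ∅ 1 𝔞 a₀ N` be the nonzero
points of `a₀ + 𝔞` whose cone exponent lies in the box `[0,N)^{r-1}` (representatives modulo `V`) and

  `D_p(s) = signedCosetSum K p 𝔞 a₀ N s = D^{p,+1}(s) - D^{p,-1}(s) = Σ_{x ∈ ℜ} sgn N(x^p) · |N_{K/ℚ}(x)|^{-s}`

(`pieceDirichlet` of `HeckePieceDirichlet.lean`; the single-sum form holds for `Re(s) > 1`,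
`signedCosetSum_eq_tsum`).  We PROVE:

* `differentiableOn_signedCosetSum`, `signedCosetSum_ofReal`: holomorphy on `Re(s) > 1` and the value at real
  points, from `HeckePieceDirichlet.lean`;
* `heckePairW_Λ_eq_signedCosetSum`: `Λ_P(s/2) = c_N A_p(s/2) D_p(s)` for `Re(s) > 1`, `P = heckePairW K p 𝔞 a₀ N`
  (Neukirch VII (8.3) `Λ(𝔎,χ,s) = L(f, s')`, `s' = (s + Tr(p)/n)/2` for `q = 0`, which is `s' = s/2` in our
  normalisation since the factor `N(y^{p/2})` sits inside `Θ̃`; from the real-`σ` identity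
  `heckePairW_Λ_real_eq` by the identity theorem);
* `exists_signedCosetSum_continuation` — **Neukirch VII (8.5) for the signed coset series**: `D_p` is the
  restriction to `Re(s) > 1` of a function meromorphic on `ℂ` and holomorphic on `ℂ ∖ {0, 1}`, namely
  `(c_N A_p(s/2))⁻¹ Λ_P(s/2)` (`A_p⁻¹` is entire; `Λ_P` has poles at most at `s/2 = 0, 1/2`, Mathlib
  `WeakFEPair.differentiableAt_Λ` = the Mellin principle VII (1.4)).

## References

* J. Neukirch, *Algebraic Number Theory*, Grundlehren 322, Springer 1999, Ch. VII §1 (1.4), §8 (8.3), (8.5)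
  and Remark 1 after (8.6). [NeukirchANT1999]
-/

noncomputable section

open MeasureTheory Filter Set Complex NumberField NumberField.InfinitePlace NumberField.Units
open scoped Real Topology ENNReal NumberField nonZeroDivisors

namespace Literature.NumberTheory.LFunctions

/-! ## The Mellin principle: `s ↦ Λ(s/2)` is meromorphic -/

/-- `s ↦ Λ_P(s/2)` is meromorphic on `ℂ` (`Λ = Λ₀ - f₀/s' - ε g₀/(k - s')` with `Λ₀` entire, Mathlib
`WeakFEPair.differentiable_Λ₀`). [folklore] -/
theorem meromorphic_weakFEPair_Λ_half (P : WeakFEPair ℂ) : Meromorphic fun s : ℂ ↦ P.Λ (s / 2) := by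
  have heq : (fun s : ℂ ↦ P.Λ (s / 2)) = fun s ↦
      P.Λ₀ (s / 2) - (1 / (s / 2)) * P.f₀ - (P.ε / ((P.k : ℂ) - s / 2)) * P.g₀ := by
    funext s
    simp only [WeakFEPair.Λ, smul_eq_mul]
  rw [heq]
  have hhalf : Differentiable ℂ (fun s : ℂ ↦ s / 2) := differentiable_id.div_const 2
  have hhalfm : Meromorphic (fun s : ℂ ↦ s / 2) := fun x ↦ (hhalf.analyticAt x).meromorphicAt
  have h0 : Meromorphic (fun s : ℂ ↦ P.Λ₀ (s / 2)) := fun x ↦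
    ((P.differentiable_Λ₀.comp hhalf).analyticAt x).meromorphicAt
  have h1 : Meromorphic (fun s : ℂ ↦ (1 / (s / 2)) * P.f₀) :=
    ((Meromorphic.const 1).div hhalfm).mul (Meromorphic.const _)
  have hlin : Meromorphic (fun s : ℂ ↦ (P.k : ℂ) - s / 2) := fun x ↦
    (((differentiable_const _).sub hhalf).analyticAt x).meromorphicAt
  have h2 : Meromorphic (fun s : ℂ ↦ (P.ε / ((P.k : ℂ) - s / 2)) * P.g₀) :=
    ((Meromorphic.const _).div hlin).mul (Meromorphic.const _)
  exact (h0.sub h1).sub h2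

namespace NumberField

variable {K : Type*} [Field K] [NumberField K]

open scoped Classical

/-! ## The signed Dirichlet series of the coset -/

/-- Membership in a sign piece of the representatives: `x` is a representative (`x ∈ pieceReps K ∅ 1 …`, i.e.
`x ≠ 0` in the coset with cone exponent in the box) and `sgn N(x^p) = ς`. [folklore] -/
theorem mem_pieceReps_iff {p : Finset {w : InfinitePlace K // IsReal w}} {ς : SignType}
    {I : FractionalIdeal (𝓞 K)⁰ K} {a₀ : K} {N : ℕ} {x : K} :
    x ∈ pieceReps K p ς I a₀ N ↔ x ∈ pieceReps K ∅ 1 I a₀ N ∧ SignType.sign (realPow K p x) = ς := by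
  simp only [pieceReps, SignPiece, Set.mem_setOf_eq, realPow_empty, sign_one]
  tauto

variable (K) in
/-- **The signed coset Dirichlet series** `D_p(s) = D^{p,+1}(s) - D^{p,-1}(s) = Σ_{x ∈ ℜ} sgn N(x^p) |N_{K/ℚ}(x)|^{-s}`
of the coset `a₀ + 𝔞` with sign weight `p` (difference of the two sign pieces `pieceDirichlet`,
`HeckePieceDirichlet.lean`; the analogue of Neukirch's `L(𝔎, χ, s) = Σ_{a ∈ ℜ} χ((a)) |N(a)|^{-s}` of VII §8 for
the data of Remark 1, `χ_f(a) N(a^p)/N(|a|^𝐬) = sgn N(a^p) |N(a)|^{-s}`).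
[cite: NeukirchANT1999, Ch. VII §8 proof of (8.3)] -/
def signedCosetSum (p : Finset {w : InfinitePlace K // IsReal w}) (I : FractionalIdeal (𝓞 K)⁰ K) (a₀ : K)
    (N : ℕ) (s : ℂ) : ℂ :=
  pieceDirichlet K p 1 I a₀ N s - pieceDirichlet K p (-1) I a₀ N s

/-- **`D_p` is holomorphic on `Re(s) > 1`** (from `differentiableOn_pieceDirichlet`). [folklore] -/
theorem differentiableOn_signedCosetSum (p : Finset {w : InfinitePlace K // IsReal w})
    (I : FractionalIdeal (𝓞 K)⁰ K) (a₀ : K) (N : ℕ) :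
    DifferentiableOn ℂ (signedCosetSum K p I a₀ N) {s | 1 < s.re} :=
  (differentiableOn_pieceDirichlet p 1 I a₀ N).sub (differentiableOn_pieceDirichlet p (-1) I a₀ N)

/-- **`D_p` at a real point**: `D_p(σ) = S⁺_p(σ) - S⁻_p(σ)` with the `ℝ≥0∞`-valued norm sums `pieceNormSum`
of `HeckeThetaDirichlet.lean` (from `pieceDirichlet_ofReal`). [folklore] -/
theorem signedCosetSum_ofReal (p : Finset {w : InfinitePlace K // IsReal w}) (I : FractionalIdeal (𝓞 K)⁰ K)
    (a₀ : K) (N : ℕ) (σ : ℝ) :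
    signedCosetSum K p I a₀ N σ =
      (((pieceNormSum K p 1 I a₀ N σ).toReal - (pieceNormSum K p (-1) I a₀ N σ).toReal : ℝ) : ℂ) := by
  rw [signedCosetSum, pieceDirichlet_ofReal, pieceDirichlet_ofReal, Complex.ofReal_sub]
  rfl

/-- The `ς`-indicator on the representatives is the indicator of the sign piece `ς`. [folklore] -/
theorem indicator_pieceReps_ite (p : Finset {w : InfinitePlace K // IsReal w}) (ς : SignType)
    (I : FractionalIdeal (𝓞 K)⁰ K) (a₀ : K) (N : ℕ) (g : K → ℂ) (x : K) :
    (pieceReps K ∅ 1 I a₀ N).indicator (fun y ↦ if SignType.sign (realPow K p y) = ς then g y else 0) x =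
      (pieceReps K p ς I a₀ N).indicator g x := by
  by_cases hx : x ∈ pieceReps K p ς I a₀ N
  · rw [Set.indicator_of_mem hx, Set.indicator_of_mem (mem_pieceReps_iff.mp hx).1, if_pos (mem_pieceReps_iff.mp hx).2]
  · rw [Set.indicator_of_notMem hx]
    by_cases hx' : x ∈ pieceReps K ∅ 1 I a₀ N
    · rw [Set.indicator_of_mem hx', if_neg (fun h ↦ hx (mem_pieceReps_iff.mpr ⟨hx', h⟩))]
    · rw [Set.indicator_of_notMem hx']

/-- **The single-sum form of `D_p`**: for `Re(s) > 1`,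
`D_p(s) = Σ_{x ∈ ℜ} sgn N(x^p) |N(x)|^{-s}` over the representatives `ℜ = pieceReps K ∅ 1 𝔞 a₀ N`
(the two sign pieces partition `ℜ`; absolute convergence from `summable_norm_pieceDirichlet_term`).
[folklore] -/
theorem signedCosetSum_eq_tsum (p : Finset {w : InfinitePlace K // IsReal w}) (I : FractionalIdeal (𝓞 K)⁰ K)
    (a₀ : K) (N : ℕ) {s : ℂ} (hs : 1 < s.re) :
    signedCosetSum K p I a₀ N s = ∑' x : pieceReps K ∅ 1 I a₀ N,
      (SignType.sign (realPow K p (x : K)) : ℂ) * ((((|(Algebra.norm ℚ (x : K) : ℚ)| : ℝ)) : ℂ) ^ (-s)) := by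
  set R := pieceReps K ∅ 1 I a₀ N with hR
  set n : K → ℂ := fun y ↦ (((|(Algebra.norm ℚ y : ℚ)| : ℝ)) : ℂ) ^ (-s) with hn
  have hsum : Summable fun x : R ↦ n x := (summable_norm_pieceDirichlet_term ∅ 1 I a₀ N hs).of_norm
  set F₁ : R → ℂ := fun x ↦ if SignType.sign (realPow K p (x : K)) = 1 then n x else 0 with hF₁
  set F₂ : R → ℂ := fun x ↦ if SignType.sign (realPow K p (x : K)) = -1 then n x else 0 with hF₂
  have hle : ∀ (ς : SignType) (x : R), ‖(if SignType.sign (realPow K p (x : K)) = ς then n x else 0)‖ ≤ ‖n x‖ := by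
    intro ς x
    split_ifs
    · exact le_rfl
    · rw [norm_zero]; exact norm_nonneg _
  have hs₁ : Summable F₁ := Summable.of_norm_bounded hsum.norm (hle 1)
  have hs₂ : Summable F₂ := Summable.of_norm_bounded hsum.norm (hle (-1))
  have hterm : ∀ x : R, (SignType.sign (realPow K p (x : K)) : ℂ) * n x = F₁ x - F₂ x := by
    intro x
    rw [hF₁, hF₂]
    rcases sign_realPow_eq_or (p := p) x.2.2.1.1 with h | h
    · simp [h]
    · simp [h]
  have hpiece : ∀ ς : SignType, ∑' x : R, (if SignType.sign (realPow K p (x : K)) = ς then n x else 0) =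
      pieceDirichlet K p ς I a₀ N s := by
    intro ς
    rw [tsum_subtype R (fun y ↦ if SignType.sign (realPow K p y) = ς then n y else 0), pieceDirichlet,
      tsum_subtype (pieceReps K p ς I a₀ N) n]
    exact tsum_congr fun y ↦ indicator_pieceReps_ite p ς I a₀ N n y
  rw [tsum_congr hterm, hs₁.tsum_sub hs₂, hF₁, hF₂, hpiece 1, hpiece (-1), signedCosetSum]

/-! ## The complex Gamma factor of weight `p` -/

variable (K) in
/-- The **complex Gamma factor of weight `p`**, `A_p(z) = ∏_w (π e_w)^{-(e_w z + p_w/2)} Γ(e_w z + p_w/2)`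
(`= realGammaFactorP K p σ` at real `z = σ`; Neukirch VII (8.3): `L_∞(χ,s) = L_X(s𝟏+p)` at `z = s/2`, up to the
normalisation of the complex places).  For `p = ∅` (`halfWeight = 0`) this is the factor `gammaFactorC K` of
`DedekindZetaClassSumCont.lean` (not in this file's import closure; to be unified by a later pass).
[cite: NeukirchANT1999, Ch. VII §8 (8.3) Proposition] -/
def gammaFactorCP (p : Finset {w : InfinitePlace K // IsReal w}) (z : ℂ) : ℂ :=
  ∏ w : InfinitePlace K, (((1 / (Real.pi * mult w) : ℝ)) : ℂ) ^ ((mult w : ℂ) * z + (halfWeight K p w : ℂ)) *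
    Complex.Gamma ((mult w : ℂ) * z + (halfWeight K p w : ℂ))

/-- `A_p` at a real point is the real Gamma factor. [folklore] -/
theorem gammaFactorCP_ofReal (p : Finset {w : InfinitePlace K // IsReal w}) (σ : ℝ) :
    gammaFactorCP K p σ = ((realGammaFactorP K p σ : ℝ) : ℂ) := by
  rw [gammaFactorCP, realGammaFactorP, Complex.ofReal_prod]
  refine Finset.prod_congr rfl fun w _ ↦ ?_
  have h0 : (0 : ℝ) ≤ 1 / (Real.pi * mult w) := by
    have : (0 : ℝ) < mult w := Nat.cast_pos.mpr mult_pos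
    positivity
  rw [Complex.ofReal_mul, Complex.ofReal_cpow h0, ← Complex.Gamma_ofReal]
  push_cast
  ring_nf

omit [NumberField K] in
/-- The base constants `(π e_w)⁻¹` are nonzero (local copy of the helper of `DedekindZetaClassSumCont.lean`,
which is not in this file's import closure). [folklore] -/
private theorem piMultBase_ne_zero (w : InfinitePlace K) : (((1 / (Real.pi * mult w) : ℝ)) : ℂ) ≠ 0 := by
  have : (0 : ℝ) < mult w := Nat.cast_pos.mpr mult_pos
  exact_mod_cast (by positivity : (1 / (Real.pi * mult w) : ℝ) ≠ 0)

omit [NumberField K] in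
/-- `Re(e_w z + p_w/2) > 0` for `Re(z) > 0`. [folklore] -/
theorem re_mult_mul_add_halfWeight_pos (p : Finset {w : InfinitePlace K // IsReal w}) (w : InfinitePlace K)
    {z : ℂ} (hz : 0 < z.re) : 0 < ((mult w : ℂ) * z + (halfWeight K p w : ℂ)).re := by
  have hm : (0 : ℝ) < mult w := Nat.cast_pos.mpr mult_pos
  have hh := halfWeight_nonneg p w
  simp only [Complex.add_re, Complex.mul_re, Complex.natCast_re, Complex.natCast_im, zero_mul, sub_zero,
    Complex.ofReal_re]
  positivity

/-- `A_p` is holomorphic on `Re(z) > 0`. [folklore] -/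
theorem differentiableAt_gammaFactorCP (p : Finset {w : InfinitePlace K // IsReal w}) {z : ℂ} (hz : 0 < z.re) :
    DifferentiableAt ℂ (gammaFactorCP K p) z := by
  set F : InfinitePlace K → ℂ → ℂ := fun w z ↦ (((1 / (Real.pi * mult w) : ℝ)) : ℂ) ^ ((mult w : ℂ) * z + (halfWeight K p w : ℂ)) *
    Complex.Gamma ((mult w : ℂ) * z + (halfWeight K p w : ℂ)) with hF
  have hd : ∀ w ∈ (Finset.univ : Finset (InfinitePlace K)), DifferentiableAt ℂ (F w) z := by
    intro w _
    have hlin : DifferentiableAt ℂ (fun z : ℂ ↦ (mult w : ℂ) * z + (halfWeight K p w : ℂ)) z :=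
      (differentiableAt_id.const_mul _).add_const _
    refine DifferentiableAt.mul ?_ ?_
    · exact DifferentiableAt.const_cpow hlin (Or.inl (piMultBase_ne_zero w))
    · refine (Complex.differentiableAt_Gamma _ fun m h ↦ ?_).comp z hlin
      have h3 := congr_arg Complex.re h
      have hpos := re_mult_mul_add_halfWeight_pos p w hz
      rw [h3] at hpos
      simp only [Complex.neg_re, Complex.natCast_re] at hpos
      linarith [(Nat.cast_nonneg m : (0:ℝ) ≤ m)]
  have key := DifferentiableAt.finsetProd hd
  have heq : (∏ w ∈ (Finset.univ : Finset (InfinitePlace K)), F w) = gammaFactorCP K p := by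
    funext z
    rw [Finset.prod_apply z Finset.univ F, gammaFactorCP]
  rw [heq] at key
  exact key

/-- `A_p(z) ≠ 0` for `Re(z) > 0`. [folklore] -/
theorem gammaFactorCP_ne_zero (p : Finset {w : InfinitePlace K // IsReal w}) {z : ℂ} (hz : 0 < z.re) :
    gammaFactorCP K p z ≠ 0 := by
  refine Finset.prod_ne_zero_iff.mpr fun w _ ↦ mul_ne_zero ?_ ?_
  · exact fun h ↦ piMultBase_ne_zero w (Complex.cpow_eq_zero_iff _ _ |>.mp h).1
  · exact Complex.Gamma_ne_zero_of_re_pos (re_mult_mul_add_halfWeight_pos p w hz)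

/-- **`A_p⁻¹` is entire** (`1/Γ` is entire, Mathlib `Complex.differentiable_one_div_Gamma`). [folklore] -/
theorem differentiable_inv_gammaFactorCP (p : Finset {w : InfinitePlace K // IsReal w}) :
    Differentiable ℂ (fun z : ℂ ↦ (gammaFactorCP K p z)⁻¹) := by
  set F : InfinitePlace K → ℂ → ℂ := fun w z ↦
    (((1 / (Real.pi * mult w) : ℝ)) : ℂ) ^ (-((mult w : ℂ) * z + (halfWeight K p w : ℂ))) *
      (Complex.Gamma ((mult w : ℂ) * z + (halfWeight K p w : ℂ)))⁻¹ with hF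
  have heq : (fun z : ℂ ↦ (gammaFactorCP K p z)⁻¹) = fun z ↦ ∏ w ∈ (Finset.univ : Finset (InfinitePlace K)), F w z := by
    funext z
    rw [gammaFactorCP, ← Finset.prod_inv_distrib]
    refine Finset.prod_congr rfl fun w _ ↦ ?_
    simp only [hF, mul_inv, Complex.cpow_neg]
  rw [heq]
  have hd : ∀ w ∈ (Finset.univ : Finset (InfinitePlace K)), Differentiable ℂ (F w) := by
    intro w _
    have hlin : Differentiable ℂ (fun z : ℂ ↦ (mult w : ℂ) * z + (halfWeight K p w : ℂ)) :=
      (differentiable_id.const_mul _).add_const _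
    refine Differentiable.mul ?_ ?_
    · exact Differentiable.const_cpow hlin.neg (Or.inl (piMultBase_ne_zero w))
    · exact Complex.differentiable_one_div_Gamma.comp hlin
  have key := Differentiable.finsetProd hd
  have heq2 : (∏ w ∈ (Finset.univ : Finset (InfinitePlace K)), F w) = fun z ↦ ∏ w ∈ Finset.univ, F w z := by
    funext z; exact Finset.prod_apply z Finset.univ F
  rw [heq2] at key
  exact key

/-! ## `Λ_P(s/2) = c_N A_p(s/2) D_p(s)` on `Re(s) > 1` -/

/-- **`Λ_P(s/2) = c_N A_p(s/2) D_p(s)` for `Re(s) > 1`**, `P = heckePairW K p 𝔞 a₀ N` — Neukirch VII (8.3)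
(`Λ(𝔎,χ,s) = L(f, s')` with `s' = (s + Tr(p - iq)/n)/2`; here `q = 0` and the shift `Tr(p)/(2n)` is absorbed
by the factor `N(y^{p/2})` inside `Θ̃`, so `s' = s/2`), extended from real `s` (`heckePairW_Λ_real_eq`,
`signedCosetSum_ofReal`) to the half-plane by the identity theorem (both sides are holomorphic on `Re(s) > 1`).
[cite: NeukirchANT1999, Ch. VII §8 (8.3) Proposition] -/
theorem heckePairW_Λ_eq_signedCosetSum (p : Finset {w : InfinitePlace K // IsReal w})
    (I : (FractionalIdeal (𝓞 K)⁰ K)ˣ) (a₀ : K) {N : ℕ} (hN0 : N ≠ 0) (hN : Even N)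
    (hV : ∀ i, (((fundSystem K i : (𝓞 K)ˣ) : K) ^ N - 1) * a₀ ∈ (I : FractionalIdeal (𝓞 K)⁰ K))
    {s : ℂ} (hs : 1 < s.re) :
    (heckePairW K p I a₀ N).Λ (s / 2) =
      ((pieceCst K N : ℝ) : ℂ) * gammaFactorCP K p (s / 2) * signedCosetSum K p (I : FractionalIdeal (𝓞 K)⁰ K) a₀ N s := by
  set P := heckePairW K p I a₀ N with hP
  obtain ⟨T, hT⟩ : ∃ T : ℂ → ℂ, T = signedCosetSum K p (I : FractionalIdeal (𝓞 K)⁰ K) a₀ N := ⟨_, rfl⟩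
  obtain ⟨G₁, hG₁⟩ : ∃ G₁ : ℂ → ℂ, G₁ = fun z ↦ P.Λ (z / 2) := ⟨_, rfl⟩
  obtain ⟨G₂, hG₂⟩ : ∃ G₂ : ℂ → ℂ, G₂ = fun z ↦ ((pieceCst K N : ℝ) : ℂ) * gammaFactorCP K p (z / 2) * T z := ⟨_, rfl⟩
  set U : Set ℂ := {z | 1 < z.re} with hU
  have hgoal : G₁ s = G₂ s → _ := fun h ↦ by
    rw [hG₁, hG₂, hT] at h
    exact h
  apply hgoal
  suffices h : Set.EqOn G₁ G₂ U from h hs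
  have hUo : IsOpen U := isOpen_lt continuous_const Complex.continuous_re
  have hUc : IsPreconnected U := (convex_halfSpace_re_gt 1).isPreconnected
  have h2 : (2 : ℂ) ∈ U := by simp [hU]
  -- analyticity of `G₁`
  have hG₁a : AnalyticOnNhd ℂ G₁ U := by
    rw [hG₁]
    refine DifferentiableOn.analyticOnNhd (fun z hz ↦ ?_) hUo
    have hz2 : (1 / 2 : ℝ) < (z / 2).re := by
      simp only [hU, Set.mem_setOf_eq] at hz
      simp only [Complex.div_ofNat_re]
      linarith
    refine DifferentiableAt.differentiableWithinAt ?_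
    refine (P.differentiableAt_Λ (Or.inl ?_) (Or.inl ?_)).comp z (differentiableAt_id.div_const 2)
    · intro h; rw [h, Complex.zero_re] at hz2; linarith
    · intro h
      rw [h] at hz2
      simp [hP, heckePairW] at hz2
  -- analyticity of `G₂`
  have hG₂a : AnalyticOnNhd ℂ G₂ U := by
    rw [hG₂]
    refine DifferentiableOn.analyticOnNhd (fun z hz ↦ ?_) hUo
    have hz1 : 1 < z.re := hz
    have hz' : 0 < (z / 2).re := by simp only [Complex.div_ofNat_re]; linarith
    have hA' : DifferentiableAt ℂ ((gammaFactorCP K p) ∘ (fun z : ℂ ↦ z / 2)) z :=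
      (differentiableAt_gammaFactorCP p hz').comp z (differentiableAt_id.div_const 2)
    have hTd : DifferentiableWithinAt ℂ T U z := by
      rw [hT]; exact differentiableOn_signedCosetSum p (I : FractionalIdeal (𝓞 K)⁰ K) a₀ N z hz
    have h3 : DifferentiableAt ℂ (fun z : ℂ ↦ ((pieceCst K N : ℝ) : ℂ) * gammaFactorCP K p (z / 2)) z :=
      (differentiableAt_const _).mul hA'
    exact h3.differentiableWithinAt.mul hTd
  -- equality at real points `x > 1`
  have hreal : ∀ x : ℝ, 1 < x → G₁ x = G₂ x := by
    intro x hx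
    have hx2 : 1 / 2 < x / 2 := by linarith
    have hΛ := heckePairW_Λ_real_eq p I a₀ hN0 hN hV hx2
    have h2x : 2 * (x / 2) = x := by ring
    rw [h2x] at hΛ
    have hcast : ((x : ℂ) / 2) = ((x / 2 : ℝ) : ℂ) := by push_cast; ring
    have hTx : T x = (((pieceNormSum K p 1 (I : FractionalIdeal (𝓞 K)⁰ K) a₀ N x).toReal -
        (pieceNormSum K p (-1) (I : FractionalIdeal (𝓞 K)⁰ K) a₀ N x).toReal : ℝ) : ℂ) := by
      rw [hT]; exact signedCosetSum_ofReal p (I : FractionalIdeal (𝓞 K)⁰ K) a₀ N x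
    rw [← hP] at hΛ
    rw [hG₁, hG₂]
    simp only []
    rw [hcast, hΛ, hTx, gammaFactorCP_ofReal]
    push_cast
    ring
  -- `G₁ = G₂` frequently near `2`
  have hfreq : ∃ᶠ z in nhdsWithin (2 : ℂ) {(2 : ℂ)}ᶜ, G₁ z = G₂ z := by
    set u : ℕ → ℝ := fun n ↦ 2 + 1 / ((n : ℝ) + 1) with hu
    have hu1 : Filter.Tendsto u Filter.atTop (nhds 2) := by
      have := tendsto_one_div_add_atTop_nhds_zero_nat.const_add (2 : ℝ)
      rwa [add_zero] at this
    have hu2 : Filter.Tendsto (fun n ↦ ((u n : ℝ) : ℂ)) Filter.atTop (nhds ((2 : ℝ) : ℂ)) :=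
      (Complex.continuous_ofReal.tendsto _).comp hu1
    have h2c : ((2 : ℝ) : ℂ) = 2 := by norm_num
    rw [h2c] at hu2
    have ht : Filter.Tendsto (fun n ↦ ((u n : ℝ) : ℂ)) Filter.atTop (nhdsWithin (2 : ℂ) {(2 : ℂ)}ᶜ) := by
      refine tendsto_nhdsWithin_of_tendsto_nhds_of_eventually_within _ hu2
        (Filter.Eventually.of_forall fun n ↦ ?_)
      simp only [Set.mem_compl_iff, Set.mem_singleton_iff]
      intro h
      rw [← h2c] at h
      have h' : u n = 2 := Complex.ofReal_injective h
      have : (0 : ℝ) < 1 / ((n : ℝ) + 1) := by positivity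
      simp only [hu] at h'
      linarith
    refine ht.frequently (Filter.Eventually.frequently (Filter.Eventually.of_forall fun n ↦ ?_))
    have hun : 1 < u n := by
      have : (0 : ℝ) < 1 / ((n : ℝ) + 1) := by positivity
      simp only [hu]
      linarith
    exact hreal (u n) hun
  exact hG₁a.eqOn_of_preconnected_of_frequently_eq hG₂a hUc h2 hfreq

/-! ## The continuation of `D_p` (Neukirch VII (8.5)) -/

/-- **Neukirch VII (8.5) for the signed coset Dirichlet series**: for a nonzero fractional ideal `𝔞`, a
shift `a₀`, an even `N ≠ 0` with `(u_i^N - 1)a₀ ∈ 𝔞`, and a set `p` of real places, the Dirichlet series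
`D_p(s) = Σ_{x ∈ ℜ} sgn N(x^p) |N(x)|^{-s}` (`Re(s) > 1`) is the restriction of a function meromorphic on `ℂ`
and holomorphic on `ℂ ∖ {0, 1}` — namely `(c_N A_p(s/2))⁻¹ Λ_P(s/2)`, `P = heckePairW K p 𝔞 a₀ N`: the Mellin
principle (VII (1.4), Mathlib `WeakFEPair`) gives `Λ_P` meromorphic with poles at most at `s/2 = 0, 1/2`, and
`A_p⁻¹` is entire.  (Neukirch: "`Λ(𝔎,χ,s)` has a meromorphic continuation … holomorphic except for poles of
order at most one at `s = Tr(-p+iq)/n` and `s = 1 + Tr(p+iq)/n`", here `q = 0` and the `Tr(p)/n` absorbed in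
our normalisation of the theta kernel.) [cite: NeukirchANT1999, Ch. VII §8 (8.5) Theorem] -/
theorem exists_signedCosetSum_continuation (p : Finset {w : InfinitePlace K // IsReal w})
    (I : (FractionalIdeal (𝓞 K)⁰ K)ˣ) (a₀ : K) {N : ℕ} (hN0 : N ≠ 0) (hN : Even N)
    (hV : ∀ i, (((fundSystem K i : (𝓞 K)ˣ) : K) ^ N - 1) * a₀ ∈ (I : FractionalIdeal (𝓞 K)⁰ K)) :
    ∃ M : ℂ → ℂ, Meromorphic M ∧ DifferentiableOn ℂ M ({0, 1} : Set ℂ)ᶜ ∧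
      ∀ s : ℂ, 1 < s.re → M s = signedCosetSum K p (I : FractionalIdeal (𝓞 K)⁰ K) a₀ N s := by
  set P := heckePairW K p I a₀ N with hP
  have hc0 : ((pieceCst K N : ℝ) : ℂ) ≠ 0 := Complex.ofReal_ne_zero.mpr (pieceCst_pos hN0).ne'
  refine ⟨fun s ↦ (((pieceCst K N : ℝ) : ℂ))⁻¹ * (gammaFactorCP K p (s / 2))⁻¹ * P.Λ (s / 2), ?_, ?_, ?_⟩
  · -- meromorphic on `ℂ`
    have hB : Differentiable ℂ ((fun z : ℂ ↦ (gammaFactorCP K p z)⁻¹) ∘ (fun s : ℂ ↦ s / 2)) :=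
      (differentiable_inv_gammaFactorCP p).comp (differentiable_id.div_const 2)
    have hBm : Meromorphic ((fun z : ℂ ↦ (gammaFactorCP K p z)⁻¹) ∘ (fun s : ℂ ↦ s / 2)) := fun x ↦
      (hB.analyticAt x).meromorphicAt
    exact ((Meromorphic.const _).mul hBm).mul (meromorphic_weakFEPair_Λ_half P)
  · -- holomorphic off `{0, 1}`
    intro s hs
    simp only [Set.mem_compl_iff, Set.mem_insert_iff, Set.mem_singleton_iff, not_or] at hs
    refine DifferentiableAt.differentiableWithinAt ?_
    have hB : DifferentiableAt ℂ ((fun z : ℂ ↦ (gammaFactorCP K p z)⁻¹) ∘ (fun s : ℂ ↦ s / 2)) s :=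
      ((differentiable_inv_gammaFactorCP p).comp (differentiable_id.div_const 2)) s
    have hΛ : DifferentiableAt ℂ (P.Λ ∘ (fun s : ℂ ↦ s / 2)) s := by
      refine (P.differentiableAt_Λ (Or.inl ?_) (Or.inl ?_)).comp s (differentiableAt_id.div_const 2)
      · exact div_ne_zero hs.1 two_ne_zero
      · intro h
        apply hs.2
        have hk : (P.k : ℂ) = ((1 / 2 : ℝ) : ℂ) := rfl
        rw [hk] at h
        have := congr_arg (fun z : ℂ ↦ 2 * z) h
        push_cast at this
        linear_combination this
    exact ((differentiableAt_const _).mul hB).mul hΛ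
  · -- the value for `Re(s) > 1`
    intro s hs
    have hs' : 0 < (s / 2).re := by simp only [Complex.div_ofNat_re]; linarith
    have hA0 := gammaFactorCP_ne_zero p hs'
    simp only []
    rw [heckePairW_Λ_eq_signedCosetSum p I a₀ hN0 hN hV hs]
    field_simp

end NumberField

end Literature.NumberTheory.LFunctions
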